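/-
Copyright (c) 2026 the pub-hodgecm-mathlib formalisation cell (harness21).  Prover seat hodgecm-mathlib-F0P3a-p04 (g16), 2026-09-01.  Road «S3-tree» (architect A-p16 (g29) A-67 (3)),
brick T3′ «depth-zero κ-transfer» (holder F0P3b-p01 (g11)), population (P-2) TYPE (2): organ O8d-2s «THE TYPE-(2) SOCKET» — the twin of ★ O8d-1s `DepthZeroKappaTransferTypeOneSocket`
(p845914): the ★ values-abstract adapter of the irreducible clause composed with ★ O8d-alg² — from the STRATA COUNTS of the two type-(2) classes to the G-side of HEAD v4's clause
`…_typeTwo`.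
-/
import Literature.NumberTheory.Rogawski1990.UnitFundamentalLemmaInertIrredClauseOfValues      -- ★ the type-(2) adapter `finsum_delta_mul_classOrbitalIntegral_eq_of_irreducible` (any `f`)
import Literature.NumberTheory.Rogawski1990.DepthZeroTransferMatrixIdentityTypeTwo         -- O8d-alg² (this seat): `depthZero_matrix_identity_typeTwo_rows`
import HarnessLib

/-!
# The type-(2) socket of T3′: from the Jordan-strata counts of the two type-(2) classes to `Σᶠ_c Δ‴_v(γ_H, c)·Φ(c, g) = M·(a₀′ W₂(N−1) + a₁′ q^N)`

Topic `NumberTheory/Rogawski1990`; namespace `Literature.NumberTheory.Rogawski1990`.  THEOREMS ONLY (no definition, no instance, no notation, no named fact, no `sorry`); kernel lane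
`--supports stmt-HodgeConjecture-24833`.  Cell `pub/hodgecm-mathlib`, crux H413; road «S3-tree», brick T3′ (holder F0P3b-p01 (g11); HEAD v4 8caecb47 clause `…_typeTwo` = DESIGN v2 §2 (P-2);
census `F0/P3a/F0P3a-p04/g16/CENSUS-T3prime-P2.F0P3a-p04g16.md`).  HONEST LABEL: HC_CM is proved only modulo the cell's 2 remaining named inputs (hLiu418, h413) until rung 0 closes;
this file is an ASSEMBLY over ★ material and asserts nothing printed.

THE STATEMENT (`finsum_finExplicitDelta_mul_classOrbitalIntegral_eq_of_irreducible_of_strata`).  In the frame of the ★ adapter (non-split `w ∣ v` unramified in `L`, `μ` unramified at `w`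
with print's guard, a matched pair `γ_H = a ↔ b = γ′` with `χ_g(u)` a unit, a block frame `γ′P = P[A 0; 0 u]` with `χ_A` IRREDUCIBLE — torus `T_K × E¹`, TWO `G′`-classes of signs `±1` —,
ANY test function `f` and ANY orbital-measure family `mG`), with the observable exponents `n = ord_w χ_g(u)` (★ `exists_irredExponents_of_hint`) and `N` (`ord_w disc χ_g = 2N+1`), suppose
the values of `f` on the classes of sign `+1` resp. `−1` are `M·(c₀ n₊(0) + c₁ n₊(1) + c₂ n₊(2))` resp. `M·(c₀ n₋(0) + c₁ n₋(1) + c₂ n₋(2))` (the shape ★ O8b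
`classOrbitalIntegral_eq_smul_sum_ncard_strata` produces for a depth-zero piece: `M = ν_G(K)`, `c_r` the stratum values, `n_±(r)` the Jordan-strata counts of the fixed hyperspecial
vertices), and suppose the three κ-SUMS of the counts are the unit row `Σ_r (n₊(r) − n₋(r)) = (−q)^n W₂(N)` (★ `flicker_theorem18n`), the level-one row `n₊(0) − n₋(0) =
(−q)^{n−2} W₂(N−1)` (C1 ∘ Cayley shift) and the free row `n₊(2) − n₋(2) = (−1)^n (q+1) q^{N+n−1}` (O8a²), `W₂ = phiHtwo q`.  Then
  `Σᶠ_c Δ‴_v(γ_H, c)·Φ(c, f) = M · ((q⁻²c₀ + ((q²−1)∕q²)c₁)·W₂(N−1) + (−q⁻¹c₁ + ((q+1)∕q)c₂)·(W₂(N) − W₂(N−1)))`,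
i.e. the G-side of HEAD v4's type-(2) clause with the SAME matrix as type (1) (the H-side `a₀Φ^st(χ₀) + a₁Φ^st(χ₁)` is this with ★ T6-2: `Φ^st(χ₀) = ν_H(K_H)W₂(N−1)`,
`Φ^st(χ₁) = ν_H(K_H)q^N`, and `W₂(N) − W₂(N−1) = q^N` ★ `phiHtwo_sub_phiHtwo_pred`).  PROOF = ★ adapter + the three rows of `depthZero_matrix_identity_typeTwo_rows` cast to `ℂ`.

## References
* [Rogawski1990] J. D. Rogawski, *Automorphic Representations of Unitary Groups in Three Variables* (1990), §4.9 Prop. 4.9.1 (a)(b) p. 55; §4.3 (4.3.1)–(4.3.2) p. 43; §8.1 Prop. 8.1.1.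
* [Flicker1998UnitaryFL] Y. Z. Flicker, *Elementary proof of the fundamental lemma for a unitary group*, Canad. J. Math. 50 (1998), Prop. 3 p. 78, §6 Thm. 18 p. 97.
-/

set_option autoImplicit false

noncomputable section

open NumberField IsDedekindDomain Matrix Polynomial
open scoped MatrixGroups

namespace Literature.NumberTheory.Rogawski1990

open Literature.NumberTheory.Automorphic Literature.NumberTheory.Automorphic.UnitaryGroup
open Literature.NumberTheory.GaloisRepresentations Literature.NumberTheory.NumberFields Literature.NumberTheory.QuadraticForms

variable (L : Type) [Field L] [NumberField L] [IsCMField L] (v : HeightOneSpectrum (𝓞 ↥(maximalRealSubfield L))) (H' : Matrix (Fin 3) (Fin 3) L)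
  (a : (UnitaryGroup.cmDatum L 2 (Matrix.of fun i j : Fin 2 => if i.val + j.val + 1 = 2 then (1 : L) else 0)).Local v ×
      (UnitaryGroup.cmDatum L 1 (Matrix.of fun i j : Fin 1 => if i.val + j.val + 1 = 1 then (1 : L) else 0)).Local v)
  (b : (UnitaryGroup.cmDatum L 3 H').Local v)
  (w : UnitaryGroup.PlacesOver L v) (hw : IsCMField.complexConj L • w.1 = w.1)

set_option maxHeartbeats 400000 in
include hw in
open scoped Classical in
/-- **THE TYPE-(2) SOCKET OF T3′** (see the module docstring): the ★ adapter's `Δ‴`-weighted class sum of ANY `f` whose two class values are strata-weighted counts with the three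
κ-sums of a depth-zero piece equals `M·(a₀′W₂(N−1) + a₁′q^N)`. [cite: Rogawski1990, §4.9 Prop. 4.9.1 (a) p. 55; §4.3 (4.3.1)–(4.3.2) p. 43] [cite: Flicker1998UnitaryFL, Prop. 3 p. 78; §6 Thm. 18 p. 97] -/
theorem finsum_finExplicitDelta_mul_classOrbitalIntegral_eq_of_irreducible_of_strata
    [∀ γ : (UnitaryGroup.cmDatum L 3 H').Local v,
    MeasurableSpace (((UnitaryGroup.cmDatum L 3 H').Local v) ⧸ Subgroup.centralizer ({γ} : Set ((UnitaryGroup.cmDatum L 3 H').Local v)))]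
    (μ : HeckeCharacter L)
    (hμω : ∀ x : ideleGroup ↥(maximalRealSubfield L), μ (AdeleRing.ideleBaseChange ↥(maximalRealSubfield L) L x) = quadraticHeckeCharCM L x)
    (hunr : Algebra.IsUnramifiedIn (𝓞 L) v.asIdeal) (hμ : μ.IsUnramifiedAt w.1)
    (hl : ∀ (v : HeightOneSpectrum (𝓞 ↥(maximalRealSubfield L)))
      (a : (UnitaryGroup.cmDatum L 2 (Matrix.of fun i j : Fin 2 => if i.val + j.val + 1 = 2 then (1 : L) else 0)).Local v ×
      (UnitaryGroup.cmDatum L 1 (Matrix.of fun i j : Fin 1 => if i.val + j.val + 1 = 1 then (1 : L) else 0)).Local v)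
      (b : (UnitaryGroup.cmDatum L 3 H').Local v)
      (x : (UnitaryGroup.cmDatum L 2 (Matrix.of fun i j : Fin 2 => if i.val + j.val + 1 = 2 then (1 : L) else 0)).Local v ×
      (UnitaryGroup.cmDatum L 1 (Matrix.of fun i j : Fin 1 => if i.val + j.val + 1 = 1 then (1 : L) else 0)).Local v),
      finExplicitDelta L v H' (x * a * x⁻¹) μ b = finExplicitDelta L v H' a μ b)
    (hr : ∀ (v : HeightOneSpectrum (𝓞 ↥(maximalRealSubfield L)))
      (a : (UnitaryGroup.cmDatum L 2 (Matrix.of fun i j : Fin 2 => if i.val + j.val + 1 = 2 then (1 : L) else 0)).Local v ×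
      (UnitaryGroup.cmDatum L 1 (Matrix.of fun i j : Fin 1 => if i.val + j.val + 1 = 1 then (1 : L) else 0)).Local v)
      (b y : (UnitaryGroup.cmDatum L 3 H').Local v),
      finExplicitDelta L v H' a μ (y * b * y⁻¹) = finExplicitDelta L v H' a μ b)
    (h : IsLocalNormPair L H' v a b) (hu : IsUnit ((finCharpolyTwo L v a).eval (finGammaTwo L v a)))
    (hH : (((UnitaryGroup.adelicForm L 3 H').map (UnitaryGroup.adeleToLocal L v)).map
      (UnitaryGroup.conjLocal L (IsCMField.complexConj L) v))ᵀ = (UnitaryGroup.adelicForm L 3 H').map (UnitaryGroup.adeleToLocal L v))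
    (hHd : IsUnit ((UnitaryGroup.adelicForm L 3 H').map (UnitaryGroup.adeleToLocal L v)).det) (e : Fin 2 ⊕ Fin 1 ≃ Fin 3)
    {P : GL (Fin 3) (UnitaryGroup.LocalRing L v)} {A : Matrix (Fin 2) (Fin 2) (UnitaryGroup.LocalRing L v)}
    (hP : (b.val.val : Matrix (Fin 3) (Fin 3) (UnitaryGroup.LocalRing L v)) * P.val = P.val * reindex e e (fromBlocks A 0 0 !![finGammaTwo L v a]))
    (hA : Irreducible A.charpoly) (mG : OrbitalMeasureFamily ((UnitaryGroup.cmDatum L 3 H').Local v))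
    (f : (UnitaryGroup.cmDatum L 3 H').Local v → ℂ)
    -- the observable exponents `(n, N)`, deepness, `q > 1`, the piece's stratum values `c`, the mass `M = ν_G(K)`, and the STRATA COUNTS `n₊ n₋` of the two classes with their three κ-sums
    (n N : ℕ) (hn : WithZero.log (Valued.v (((finCharpolyTwo L v a).eval (finGammaTwo L v a)) w)) = -(n : ℤ)) (hn2 : 2 ≤ n) (hN : 1 ≤ N)
    (hq : 1 < Ideal.absNorm v.asIdeal) (M : ℂ) (c : ℕ → ℂ) (np nm : ℕ → ℕ)
    (hK : ((np 0 + np 1 + np 2 : ℕ) : ℚ) - ((nm 0 + nm 1 + nm 2 : ℕ) : ℚ) = (-(Ideal.absNorm v.asIdeal : ℚ)) ^ n * Flicker1998.phiHtwo (Ideal.absNorm v.asIdeal) N)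
    (hK₀ : ((np 0 : ℕ) : ℚ) - ((nm 0 : ℕ) : ℚ) = (-(Ideal.absNorm v.asIdeal : ℚ)) ^ (n - 2) * Flicker1998.phiHtwo (Ideal.absNorm v.asIdeal) (N - 1))
    (hK₂ : ((np 2 : ℕ) : ℚ) - ((nm 2 : ℕ) : ℚ) = (-1 : ℚ) ^ n * ((Ideal.absNorm v.asIdeal : ℚ) + 1) * (Ideal.absNorm v.asIdeal : ℚ) ^ (N + n - 1))
    (hΦ : ∀ δ : (UnitaryGroup.cmDatum L 3 H').Local v, IsLocalNormPair L H' v a δ → finKappaAt L v H' a δ = 1 →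
      classOrbitalIntegral mG f (ConjClasses.mk δ) = M * (c 0 * (np 0 : ℂ) + c 1 * (np 1 : ℂ) + c 2 * (np 2 : ℂ)))
    (hΦ' : ∀ δ : (UnitaryGroup.cmDatum L 3 H').Local v, IsLocalNormPair L H' v a δ → finKappaAt L v H' a δ = -1 →
      classOrbitalIntegral mG f (ConjClasses.mk δ) = M * (c 0 * (nm 0 : ℂ) + c 1 * (nm 1 : ℂ) + c 2 * (nm 2 : ℂ))) :
    ∑ᶠ cG : ConjClasses ((UnitaryGroup.cmDatum L 3 H').Local v),
        (finExplicitCollection L H' μ hl hr v).Δ a (Quotient.out cG) * classOrbitalIntegral mG f cG =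
      M * (((((Ideal.absNorm v.asIdeal : ℂ)) ^ 2)⁻¹ * c 0 + ((((Ideal.absNorm v.asIdeal : ℂ)) ^ 2 - 1) / ((Ideal.absNorm v.asIdeal : ℂ)) ^ 2) * c 1) *
          ((Flicker1998.phiHtwo (Ideal.absNorm v.asIdeal) (N - 1) : ℚ) : ℂ) +
        (-((Ideal.absNorm v.asIdeal : ℂ))⁻¹ * c 1 + ((((Ideal.absNorm v.asIdeal : ℂ)) + 1) / ((Ideal.absNorm v.asIdeal : ℂ))) * c 2) *
          ((Flicker1998.phiHtwo (Ideal.absNorm v.asIdeal) N - Flicker1998.phiHtwo (Ideal.absNorm v.asIdeal) (N - 1) : ℚ) : ℂ)) := by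
  -- the ★ adapter with the two values `X := M · Σ_r c_r n₊(r)`, `X′ := M · Σ_r c_r n₋(r)`
  rw [finsum_delta_mul_classOrbitalIntegral_eq_of_irreducible L v H' a b w hw μ hμω hunr hμ hl hr h hu hH hHd e hP hA mG f hΦ hΦ', hn]
  -- the three rows of the type-(2) matrix identity (O8d-alg²), cast to `ℂ`
  obtain ⟨r0, r1, r2⟩ := Flicker1998.depthZero_matrix_identity_typeTwo_rows hq hn2 hN hK hK₀ hK₂
  have hz : (-(Ideal.absNorm v.asIdeal : ℂ)) ^ (-(n : ℤ)) = ((-(Ideal.absNorm v.asIdeal : ℂ)) ^ n)⁻¹ := by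
    rw [_root_.zpow_neg, zpow_natCast]
  have r0' := congrArg (fun x : ℚ => (x : ℂ)) r0
  have r1' := congrArg (fun x : ℚ => (x : ℂ)) r1
  have r2' := congrArg (fun x : ℚ => (x : ℂ)) r2
  push_cast at r0' r1' r2'
  rw [hz]
  push_cast
  linear_combination M * (c 0 * r0' + c 1 * r1' + c 2 * r2')

end Literature.NumberTheory.Rogawski1990

end
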